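import Mathlib.Geometry.Manifold.VectorBundle.Basic
import Mathlib.Analysis.InnerProductSpace.PiL2
import Mathlib.Topology.Algebra.Module.FiniteDimension
import Literature.Geometry.Kaehler.HolomorphicLineBundle
import HarnessLib

/-!
# Hermitian holomorphic vector bundles: the Chern connection and its curvature

Layer `Literature/Geometry/Kaehler`; the rank-`r` companion of the rank-one, cocycle-presented
`HolomorphicLineBundle` / `HermitianMetric` / `localChernForm` of `HolomorphicLineBundle.lean`,
requested by the analytic items of route `HodgeConjecture/AffinePartDecay` (finite-energy and
Hermitian–Yang–Mills metrics for a Poincaré-type Kähler metric). Source: Kobayashi (1987),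
Ch. I §4, Ch. III §1 [Kobayashi1987]. The metric-dependent notions — contraction `Λ`, mean
curvature `K = iΛΩ`, the Einstein (Hermitian–Yang–Mills) condition, pointwise norms `|K|²_h`,
`|Ω|²_{h,g}` — are in the sequel `HermitianHolomorphicBundleMeanCurvature.lean`.

* A **holomorphic vector bundle** on the complex manifold `M` (charts in the complex normed space
  `E`, `[IsManifold 𝓘(ℂ, E) ω M]`) is Mathlib's `[VectorBundle ℂ F V] [ContMDiffVectorBundle ω F V
  𝓘(ℂ, E)]`: fibres `V x`, model fibre `F` (a finite-dimensional complex inner product space, e.g.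
  `EuclideanSpace ℂ (Fin r)`; its inner product is only a REFERENCE used to write matrices as
  operators), trivialisation changes analytic over `ℂ`, i.e. holomorphic. The trivialisations
  `e = trivializationAt F V x₀` of the atlas are the local holomorphic frames: `s(x) = e.symmₗ ℂ x`
  identifies `F` with `V x` over `e.baseSet` (Kobayashi's frame field `s_U = (s_1, …, s_r)` is
  `s_i = e.symmₗ ℂ x bᵢ` for the orthonormal basis `b = stdOrthonormalBasis ℂ F`).
* `HermitianHolomorphicBundle E F V`: an **Hermitian structure** `h` on such a `V` (I.(4.1)): a
  positive definite Hermitian inner product `h.inner x` on every fibre, `C^∞` in the sense that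
  the functions `h(s v, s w)` are real-`C^∞` on the domain of every holomorphic frame `s` of the
  atlas. CONVENTION: `h.inner x v w` is conjugate-linear in `v` and linear in `w` (Mathlib's
  order; Kobayashi's `h(ξ, η)` is `h.inner x η ξ`).
* In the frame at `x₀`: `h.frameForm x₀ x` (the form `(v, w) ↦ h(s v, s w)` on `F`) and the
  positive operator `H = h.frameOp x₀ x : F →L[ℂ] F`, `⟪H v, w⟫ = h(s v, s w)` (`inner_frameOp`).
  Its matrix in the basis `b` is the TRANSPOSE of Kobayashi's `H_U = (h(s_i, s_j))` (I.(4.2)), so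
  that his connection form `ω`, `ᵗω = d′H_U · H_U⁻¹` (I.(4.11)), is the operator-valued form
  `θ = H⁻¹ d′H = h.connectionForm x₀` — the **Chern (Hermitian) connection** `D = d + θ`,
  `h.covDeriv` (I.(4.9): the unique `h`-connection with `D″ = d″`; III.(1.1)–(1.2)) — and his
  curvature form `Ω = d″ω`, "the `(1,1)`-component of `dω + ω ∧ ω`" (I.(4.13), (4.17)), is
  `h.curvatureForm x₀ = (dθ)^{1,1}`, an `End F = (F →L[ℂ] F)`-valued real `2`-form on `M`
  (meaningful on `e.baseSet`; `R(s_j) = Σ Ωⁱⱼ sᵢ`).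
* `d′`, `d″` of vector-valued functions and the `(1,1)`-part of a `2`-form are written with the
  complex structure `J = tangentJ E x` only (as `localChernForm` is): `d′f = ½(df − i df∘J)`,
  `d″f = ½(df + i df∘J)`, `β^{1,1} = ½(β + β(J·, J·))` (`dPrime`, `dDoublePrime`,
  `MForm.oneOnePart`); `d` is the tree's `mextDeriv`.
* Sanity: the product bundle `Bundle.Trivial M F` with the constant structure `⟪·, ·⟫`
  (`HermitianHolomorphicBundle.trivial`) has `H = id`, `θ = 0`, `Ω = 0` (proved below).

## What is NOT here

Frame-change formulas (I.(4.4), (1.16)) and the frame-independence of `Ω` as a section of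
`End V`; `D² = Ω`; Chern forms `c_k(E, h)` (II.§2) and the comparison with `localChernForm` in
rank one; the Kobayashi–Hitchin correspondence, heat flow, Poincaré-type metrics (route items).
Mathlib (this pin) has no connections or curvature on vector bundles and no Hermitian metrics on
complex bundles (searched `covariantDeriv`, `Connection`, `curvature`, `Hermitian`: no Mathlib
declaration; only real fibre metrics `Bundle.RiemannianMetric`).

## References

* S. Kobayashi, *Differential Geometry of Complex Vector Bundles*, Princeton UP (1987), I.§4
  (4.1)–(4.4), Prop. (4.9), (4.10)–(4.13), Prop. (4.17); III.§1 (1.1)–(1.3) [Kobayashi1987].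
* C. Voisin, *Hodge Theory and Complex Algebraic Geometry I* (2002), §3.1.1 (proof of Lemma
  3.3: `(1,1)`-forms and `I`-invariance) [VoisinHodgeI2002].
* Companion (cocycle-presented `C^∞` bundles, connections `ω_U`, `Ω = dω + ω ∧ ω`, Chern
  character forms): `Literature/Geometry/Kaehler/ComplexVectorBundle.lean`. This file is on
  Mathlib bundles instead, as are the sibling requests `topologicalChernCharacter` (Mathlib
  `VectorBundle ℂ F V`) and `PoincareTypeMetric` (a `RiemannianMetric` on `T(M ∖ D)`).
-/

noncomputable section

open scoped Manifold ContDiff Topology ComplexConjugate InnerProductSpace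
open Bundle Set Module

namespace Literature.Geometry.Kaehler

/-! ### `d′`, `d″` of vector-valued functions; the `(1,1)`-part of a `2`-form -/

section TypeOperators

variable {E : Type*} [NormedAddCommGroup E] [NormedSpace ℂ E]
  {M : Type*} [TopologicalSpace M] [ChartedSpace E M]
  {W : Type*} [NormedAddCommGroup W] [NormedSpace ℝ W] {k : ℕ}

/-- `J^*β`: precomposition of a `k`-form with the complex structure in every slot,
`(J^*β)(v₁, …, v_k) = β(Jv₁, …, Jv_k)` (for `k = 1` this is `MForm.compJ`, definitionally).
[cite: VoisinHodgeI2002, §3.1] -/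
def MForm.pullbackJ (β : MForm 𝓘(ℝ, E) M W k) : MForm 𝓘(ℝ, E) M W k := fun x ↦
  (β x).compContinuousLinearMap (tangentJ E x)

/-- Evaluation of `J^*β` (definitional). [folklore] -/
@[simp]
theorem MForm.pullbackJ_apply (β : MForm 𝓘(ℝ, E) M W k) (x : M)
    (v : Fin k → TangentSpace 𝓘(ℝ, E) x) : β.pullbackJ x v = β x (fun i ↦ tangentJ E x (v i)) :=
  rfl

/-- `J^*0 = 0`. [folklore] -/
@[simp]
theorem MForm.pullbackJ_zero : (0 : MForm 𝓘(ℝ, E) M W k).pullbackJ = 0 := rfl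

/-- The **`(1,1)`-part** of a `2`-form: `β^{1,1} = ½(β + J^*β)`. A `2`-form of type
`(2,0) + (0,2)` satisfies `β(Jv, Jw) = -β(v, w)`, one of type `(1,1)` satisfies
`β(Jv, Jw) = β(v, w)` (e.g. `dz ∧ dz̄`), whence the projection formula (Voisin I, §2.3.3 / Lemma
3.3: a real `2`-form is of type `(1,1)` iff it is `J`-invariant). [cite: VoisinHodgeI2002, §3.1.1] -/
def MForm.oneOnePart (β : MForm 𝓘(ℝ, E) M W 2) : MForm 𝓘(ℝ, E) M W 2 :=
  (2⁻¹ : ℝ) • (β + β.pullbackJ)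

/-- `0^{1,1} = 0`. [folklore] -/
@[simp]
theorem MForm.oneOnePart_zero : (0 : MForm 𝓘(ℝ, E) M W 2).oneOnePart = 0 := by
  simp [MForm.oneOnePart]

/-- The `(1,1)`-part is `J`-invariant: `J^*(β^{1,1}) = β^{1,1}` (as `J² = -1`), i.e. `β^{1,1}` is
of type `(1,1)`. [cite: VoisinHodgeI2002, §3.1.1] -/
theorem MForm.pullbackJ_oneOnePart (β : MForm 𝓘(ℝ, E) M W 2) :
    β.oneOnePart.pullbackJ = β.oneOnePart := by
  funext x
  ext v
  simp only [MForm.oneOnePart, MForm.pullbackJ_apply, Pi.smul_apply, Pi.add_apply,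
    ContinuousAlternatingMap.smul_apply, ContinuousAlternatingMap.add_apply, tangentJ_tangentJ]
  rw [add_comm (β x _)]
  congr 2
  have : (fun i ↦ -v i) = fun i ↦ (-1 : ℝ) • v i := by simp
  rw [this, ContinuousAlternatingMap.map_smul_univ]
  simp

end TypeOperators

section TypeOperatorsComplex

variable {E : Type*} [NormedAddCommGroup E] [NormedSpace ℂ E]
  {M : Type*} [TopologicalSpace M] [ChartedSpace E M]
  {W : Type*} [NormedAddCommGroup W] [NormedSpace ℂ W]

variable (E) in
/-- `d′f`, the `(1,0)`-part of the differential of a vector-valued function on a complex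
manifold: `d′f = ½ (df - i · df ∘ J)` (on `ℂ`: `d′z = dz`, `d′z̄ = 0`). Kobayashi's `d′`
(I.§3–§4); `∂` elsewhere. [cite: Kobayashi1987, I.(4.10)] -/
def dPrime (f : M → W) : MForm 𝓘(ℝ, E) M W 1 :=
  (2⁻¹ : ℂ) • (mextDeriv (MForm.ofFun 𝓘(ℝ, E) f) -
    Complex.I • (mextDeriv (MForm.ofFun 𝓘(ℝ, E) f)).pullbackJ)

variable (E) in
/-- `d″f`, the `(0,1)`-part of the differential of a vector-valued function:
`d″f = ½ (df + i · df ∘ J)`; `d = d′ + d″`. Kobayashi's `d″` (`∂̄` elsewhere).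
[cite: Kobayashi1987, I.(4.9)] -/
def dDoublePrime (f : M → W) : MForm 𝓘(ℝ, E) M W 1 :=
  (2⁻¹ : ℂ) • (mextDeriv (MForm.ofFun 𝓘(ℝ, E) f) +
    Complex.I • (mextDeriv (MForm.ofFun 𝓘(ℝ, E) f)).pullbackJ)

/-- `d′f + d″f = df`. [folklore] -/
theorem dPrime_add_dDoublePrime (f : M → W) :
    dPrime E f + dDoublePrime E f = mextDeriv (MForm.ofFun 𝓘(ℝ, E) f) := by
  simp only [dPrime, dDoublePrime, ← smul_add, sub_add_add_cancel, ← two_smul ℂ, smul_smul]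
  norm_num

/-- `d′` of a constant vanishes. [folklore] -/
theorem dPrime_const (a : W) : dPrime E (fun _ : M ↦ a) = 0 := by
  simp [dPrime, mextDeriv_ofFun_const]

/-- `d″` of a constant vanishes. [folklore] -/
theorem dDoublePrime_const (a : W) : dDoublePrime E (fun _ : M ↦ a) = 0 := by
  simp [dDoublePrime, mextDeriv_ofFun_const]

end TypeOperatorsComplex

/-! ### `End`-valued forms: products and evaluation -/

section EndForms

variable {E : Type*} [NormedAddCommGroup E] [NormedSpace ℂ E]
  {M : Type*} [TopologicalSpace M] [ChartedSpace E M]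
  {F : Type*} [NormedAddCommGroup F] [NormedSpace ℂ F] {k : ℕ}

/-- Left multiplication of an `End F`-valued form by an `End F`-valued function:
`(A · α)(v) = A ∘ α(v)` (matrix product of matrix-valued forms). [folklore] -/
def MForm.endMulLeft (A : M → (F →L[ℂ] F)) (α : MForm 𝓘(ℝ, E) M (F →L[ℂ] F) k) :
    MForm 𝓘(ℝ, E) M (F →L[ℂ] F) k := fun x ↦
  ((ContinuousLinearMap.mul ℂ (F →L[ℂ] F) (A x)).restrictScalars ℝ).compContinuousAlternatingMap
    (α x)

/-- Evaluation of `A · α` (definitional). [folklore] -/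
@[simp]
theorem MForm.endMulLeft_apply (A : M → (F →L[ℂ] F)) (α : MForm 𝓘(ℝ, E) M (F →L[ℂ] F) k)
    (x : M) (v : Fin k → TangentSpace 𝓘(ℝ, E) x) :
    MForm.endMulLeft A α x v = (A x).comp (α x v) :=
  rfl

/-- `A · 0 = 0`. [folklore] -/
@[simp]
theorem MForm.endMulLeft_zero (A : M → (F →L[ℂ] F)) :
    MForm.endMulLeft A (0 : MForm 𝓘(ℝ, E) M (F →L[ℂ] F) k) = 0 := by
  funext x; ext v; simp

/-- Evaluation of an `End F`-valued form on an `F`-valued function: `(α u)(v) = α(v)(u)`.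
[folklore] -/
def MForm.endApply (α : MForm 𝓘(ℝ, E) M (F →L[ℂ] F) k) (u : M → F) : MForm 𝓘(ℝ, E) M F k :=
  fun x ↦ ((ContinuousLinearMap.apply ℂ F (u x)).restrictScalars ℝ).compContinuousAlternatingMap
    (α x)

/-- Evaluation of `α u` (definitional). [folklore] -/
@[simp]
theorem MForm.endApply_apply (α : MForm 𝓘(ℝ, E) M (F →L[ℂ] F) k) (u : M → F) (x : M)
    (v : Fin k → TangentSpace 𝓘(ℝ, E) x) : α.endApply u x v = α x v (u x) :=
  rfl

end EndForms

/-! ### Hermitian holomorphic vector bundles -/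

/-- A **Hermitian holomorphic vector bundle `(V, h)`**: an Hermitian structure `h` (Kobayashi
I.(4.1): "a `C^∞` field of Hermitian inner products in the fibers") on a HOLOMORPHIC vector
bundle `V → M` — Mathlib's `[VectorBundle ℂ F V] [ContMDiffVectorBundle ω F V 𝓘(ℂ, E)]` over
the complex manifold `M`, model fibre a finite-dimensional complex inner product space `F` (rank
`= finrank ℂ F`; e.g. `EuclideanSpace ℂ (Fin r)`). Data: the fibre inner products
`h.inner x : V x →ₗ⋆[ℂ] V x →ₗ[ℂ] ℂ` (conjugate-linear in the FIRST variable — Mathlib's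
convention; Kobayashi's `h(ξ, η) = h.inner x η ξ`), Hermitian symmetric and positive definite,
and `C^∞` (for the real structure `𝓘(ℝ, E)` of `M`) along every holomorphic frame of the atlas:
`x ↦ h(s v, s w)`, `s = (trivializationAt F V x₀).symmₗ ℂ x`, is smooth on the frame's domain
(I.(4.1): "`h(ξ, η)` is `C^∞` if `ξ`, `η` are `C^∞` sections"; frames suffice by
sesquilinearity). [cite: Kobayashi1987, I.(4.1)] -/
structure HermitianHolomorphicBundle (E : Type*) [NormedAddCommGroup E] [NormedSpace ℂ E]
    {M : Type*} [TopologicalSpace M] [ChartedSpace E M]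
    (F : Type*) [NormedAddCommGroup F] [InnerProductSpace ℂ F] [FiniteDimensional ℂ F]
    (V : M → Type*) [TopologicalSpace (TotalSpace F V)] [∀ x, TopologicalSpace (V x)]
    [∀ x, AddCommGroup (V x)] [∀ x, Module ℂ (V x)] [FiberBundle F V] [VectorBundle ℂ F V]
    [IsManifold 𝓘(ℂ, E) ω M] [ContMDiffVectorBundle ω F V 𝓘(ℂ, E)] where
  /-- The Hermitian inner product `h_x` on the fibre `V x` (conjugate-linear in the first
  variable). [cite: Kobayashi1987, I.(4.1)] -/
  inner : ∀ x, V x →ₗ⋆[ℂ] V x →ₗ[ℂ] ℂ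
  /-- Hermitian symmetry `conj h(w, v) = h(v, w)`. [cite: Kobayashi1987, I.(4.1)] -/
  inner_conj_symm : ∀ x (v w : V x), conj (inner x w v) = inner x v w
  /-- Positivity `h(v, v) > 0` for `v ≠ 0`. [cite: Kobayashi1987, I.(4.1)] -/
  inner_self_pos : ∀ x (v : V x), v ≠ 0 → 0 < (inner x v v).re
  /-- Smoothness: `h(s v, s w)` is real-`C^∞` on the domain of each holomorphic frame `s` of the
  atlas. [cite: Kobayashi1987, I.(4.1)] -/
  contMDiffOn_inner : ∀ (x₀ : M) (v w : F),
    ContMDiffOn 𝓘(ℝ, E) 𝓘(ℝ, ℂ) ∞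
      (fun x ↦ inner x ((trivializationAt F V x₀).symmₗ ℂ x v)
        ((trivializationAt F V x₀).symmₗ ℂ x w))
      (trivializationAt F V x₀).baseSet

namespace HermitianHolomorphicBundle

variable {E : Type*} [NormedAddCommGroup E] [NormedSpace ℂ E]
  {M : Type*} [TopologicalSpace M] [ChartedSpace E M]
  {F : Type*} [NormedAddCommGroup F] [InnerProductSpace ℂ F] [FiniteDimensional ℂ F]
  {V : M → Type*} [TopologicalSpace (TotalSpace F V)] [∀ x, TopologicalSpace (V x)]
  [∀ x, AddCommGroup (V x)] [∀ x, Module ℂ (V x)] [FiberBundle F V] [VectorBundle ℂ F V]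
  [IsManifold 𝓘(ℂ, E) ω M] [ContMDiffVectorBundle ω F V 𝓘(ℂ, E)]

/-- `h(v, v)` is real. [folklore] -/
theorem inner_self_im (h : HermitianHolomorphicBundle E F V) (x : M) (v : V x) :
    (h.inner x v v).im = 0 := by
  have := h.inner_conj_symm x v v
  rwa [Complex.conj_eq_iff_im] at this

/-! #### The metric in a holomorphic frame: `H_U` -/

/-- The metric read in the holomorphic frame at `x₀`: the Hermitian form
`(v, w) ↦ h(s v, s w)` on the model fibre `F`, `s = (trivializationAt F V x₀).symmₗ ℂ x`
(Kobayashi's `h_{ij̄} = h(s_i, s_j)`, I.(4.2), up to his argument order). Meaningful for `x` in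
the frame's domain (`symmₗ` is `0` off it). [cite: Kobayashi1987, I.(4.2)] -/
def frameForm (h : HermitianHolomorphicBundle E F V) (x₀ x : M) : F →ₗ⋆[ℂ] F →ₗ[ℂ] ℂ :=
  ((h.inner x).comp ((trivializationAt F V x₀).symmₗ ℂ x)).compl₂
    ((trivializationAt F V x₀).symmₗ ℂ x)

/-- Unfolding of `frameForm` (definitional). [folklore] -/
@[simp]
theorem frameForm_apply (h : HermitianHolomorphicBundle E F V) (x₀ x : M) (v w : F) :
    h.frameForm x₀ x v w = h.inner x ((trivializationAt F V x₀).symmₗ ℂ x v)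
      ((trivializationAt F V x₀).symmₗ ℂ x w) :=
  rfl

/-- The metric in the holomorphic frame at `x₀` as an OPERATOR `H : F →L[ℂ] F` for the reference
inner product of `F`: `⟪H v, w⟫ = h(s v, s w)` (`inner_frameOp`; Riesz representation, written
in the orthonormal basis `b = stdOrthonormalBasis ℂ F` as `H v = Σₖ conj (h(s v, s bₖ)) bₖ`).
Its matrix in `b` is `ᵗH_U` for Kobayashi's `H_U = (h(s_i, s_j))`, `s_i = s bᵢ` (I.(4.2)–(4.4));
`H` is positive definite on the frame's domain. [cite: Kobayashi1987, I.(4.2)] -/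
def frameOp (h : HermitianHolomorphicBundle E F V) (x₀ x : M) : F →L[ℂ] F :=
  LinearMap.toContinuousLinearMap
    { toFun := fun v ↦ ∑ k, conj (h.frameForm x₀ x v (stdOrthonormalBasis ℂ F k)) •
        stdOrthonormalBasis ℂ F k
      map_add' := fun v w ↦ by
        simp only [map_add, LinearMap.add_apply, add_smul, Finset.sum_add_distrib]
      map_smul' := fun c v ↦ by
        simp only [LinearMap.map_smulₛₗ₂, smul_eq_mul, map_mul, Complex.conj_conj,
          RingHom.id_apply, Finset.smul_sum, smul_smul] }

/-- **`H` represents `h` in the frame**: `⟪H v, w⟫ = h(s v, s w)`. [cite: Kobayashi1987, I.(4.2)] -/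
theorem inner_frameOp (h : HermitianHolomorphicBundle E F V) (x₀ x : M) (v w : F) :
    ⟪h.frameOp x₀ x v, w⟫_ℂ = h.frameForm x₀ x v w := by
  simp only [frameOp, LinearMap.coe_toContinuousLinearMap', LinearMap.coe_mk, AddHom.coe_mk,
    sum_inner, inner_smul_left, Complex.conj_conj]
  calc ∑ k, h.frameForm x₀ x v (stdOrthonormalBasis ℂ F k) * ⟪stdOrthonormalBasis ℂ F k, w⟫_ℂ
      = ∑ k, h.frameForm x₀ x v (⟪stdOrthonormalBasis ℂ F k, w⟫_ℂ • stdOrthonormalBasis ℂ F k) :=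
        Finset.sum_congr rfl fun k _ ↦ by rw [map_smul, smul_eq_mul, mul_comm]
    _ = h.frameForm x₀ x v w := by rw [← map_sum, (stdOrthonormalBasis ℂ F).sum_repr' w]

/-! #### Chern connection and curvature in a holomorphic frame -/

/-- The **connection form of the Chern (Hermitian) connection** in the holomorphic frame at `x₀`:
the `End F`-valued `(1,0)`-form `θ = H⁻¹ d′H` — Kobayashi's `ω = (ωⁱⱼ)`, `ᵗω = d′H_U H_U⁻¹`
(I.(4.11), proof of Prop. (4.9): the unique `h`-connection with `D″ = d″`), transposed into
operator language (`H = ᵗH_U`, see `frameOp`). `H⁻¹` is `ContinuousLinearMap.inverse` (`H` is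
invertible on the frame's domain; junk `0` off it). [cite: Kobayashi1987, I.(4.11)] -/
def connectionForm (h : HermitianHolomorphicBundle E F V) (x₀ : M) :
    MForm 𝓘(ℝ, E) M (F →L[ℂ] F) 1 :=
  MForm.endMulLeft (fun x ↦ (h.frameOp x₀ x).inverse) (dPrime E (h.frameOp x₀))

/-- Evaluation of the connection form: `θ(v) = H⁻¹ ∘ (d′H)(v)`. [cite: Kobayashi1987, I.(4.11)] -/
theorem connectionForm_apply (h : HermitianHolomorphicBundle E F V) (x₀ x : M)
    (v : Fin 1 → TangentSpace 𝓘(ℝ, E) x) :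
    h.connectionForm x₀ x v = (h.frameOp x₀ x).inverse.comp (dPrime E (h.frameOp x₀) x v) :=
  rfl

/-- The **Chern connection** on sections written in the holomorphic frame at `x₀`
(`ξ = s u`, `u : M → F`): `Du = du + θu`, i.e. `D′u = d′u + θu`, `D″u = d″u`
(Kobayashi III.(1.1)–(1.2), I.(4.9)). [cite: Kobayashi1987, III.(1.1)] -/
def covDeriv (h : HermitianHolomorphicBundle E F V) (x₀ : M) (u : M → F) : MForm 𝓘(ℝ, E) M F 1 :=
  mextDeriv (MForm.ofFun 𝓘(ℝ, E) u) + (h.connectionForm x₀).endApply u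

/-- Evaluation of the covariant derivative: `(Du)(v) = du(v) + θ(v) u`. [cite: Kobayashi1987, III.(1.1)] -/
theorem covDeriv_apply (h : HermitianHolomorphicBundle E F V) (x₀ : M) (u : M → F) (x : M)
    (v : Fin 1 → TangentSpace 𝓘(ℝ, E) x) :
    h.covDeriv x₀ u x v = mextDeriv (MForm.ofFun 𝓘(ℝ, E) u) x v + h.connectionForm x₀ x v (u x) :=
  rfl

/-- The **curvature form `Ω` of the Chern connection** in the holomorphic frame at `x₀`: the
`End F`-valued `2`-form `Ω = d″θ = (dθ)^{1,1}`, "the `(1,1)`-component of `dω + ω ∧ ω`"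
(Kobayashi I.(4.13); Prop. (4.17): the curvature `R = D ∘ D` is of degree `(1,1)`, and
`R(s_j) = Σ Ωⁱⱼ sᵢ`, III.(1.3)). A form on all of `M`, meaningful on the frame's domain.
[cite: Kobayashi1987, I.(4.13)] -/
def curvatureForm (h : HermitianHolomorphicBundle E F V) (x₀ : M) :
    MForm 𝓘(ℝ, E) M (F →L[ℂ] F) 2 :=
  (mextDeriv (h.connectionForm x₀)).oneOnePart

/-- **The curvature is of degree `(1,1)`**: `Ω(Jv, Jw) = Ω(v, w)` (Kobayashi I, Prop. (4.17)).
[cite: Kobayashi1987, I.(4.17)] -/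
theorem pullbackJ_curvatureForm (h : HermitianHolomorphicBundle E F V) (x₀ : M) :
    (h.curvatureForm x₀).pullbackJ = h.curvatureForm x₀ :=
  MForm.pullbackJ_oneOnePart _

/-! #### The flat product bundle -/

variable (E M F) in
/-- The **product bundle `M × F` with the constant Hermitian structure** `h_x = ⟪·, ·⟫_F`
(Kobayashi I.§4: a unitary frame field, `H_U = 1`). [cite: Kobayashi1987, I.(4.3)] -/
def trivial : HermitianHolomorphicBundle E F (Bundle.Trivial M F) where
  inner _ := innerₛₗ ℂ
  inner_conj_symm _ v w := _root_.inner_conj_symm v w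
  inner_self_pos _ v hv := by simpa [innerₛₗ_apply_apply] using (re_inner_self_pos (𝕜 := ℂ)).2 hv
  contMDiffOn_inner x₀ v w := by
    refine (contMDiffOn_const (c := ⟪v, w⟫_ℂ)).congr fun x _ ↦ ?_
    change ⟪(Bundle.Trivial.trivialization M F).symmₗ ℂ x v,
      (Bundle.Trivial.trivialization M F).symmₗ ℂ x w⟫_ℂ = ⟪v, w⟫_ℂ
    rw [Trivialization.symmₗ_apply _ (mem_univ x), Trivialization.symmₗ_apply _ (mem_univ x),
      Bundle.Trivial.trivialization_symm_apply, Bundle.Trivial.trivialization_symm_apply]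

/-- In its (global) frame the constant structure reads `⟪v, w⟫`. [folklore] -/
theorem trivial_frameForm (x₀ x : M) (v w : F) : (trivial E M F).frameForm x₀ x v w = ⟪v, w⟫_ℂ := by
  change ⟪(Bundle.Trivial.trivialization M F).symmₗ ℂ x v,
    (Bundle.Trivial.trivialization M F).symmₗ ℂ x w⟫_ℂ = _
  rw [Trivialization.symmₗ_apply _ (mem_univ x), Trivialization.symmₗ_apply _ (mem_univ x),
    Bundle.Trivial.trivialization_symm_apply, Bundle.Trivial.trivialization_symm_apply]

/-- Hence `H = 1` (a unitary frame, Kobayashi I.(4.3)). [cite: Kobayashi1987, I.(4.3)] -/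
theorem trivial_frameOp (x₀ x : M) : (trivial E M F).frameOp x₀ x = ContinuousLinearMap.id ℂ F := by
  ext v
  refine ext_inner_right ℂ fun w ↦ ?_
  rw [inner_frameOp, trivial_frameForm, ContinuousLinearMap.id_apply]

/-- The connection form of the flat product structure vanishes: `θ = 1⁻¹ d′1 = 0`. [folklore] -/
theorem trivial_connectionForm (x₀ : M) : (trivial E M F).connectionForm x₀ = 0 := by
  have h : (trivial E M F).frameOp x₀ = fun _ ↦ ContinuousLinearMap.id ℂ F :=
    funext (trivial_frameOp x₀)
  rw [connectionForm, h, dPrime_const, MForm.endMulLeft_zero]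

/-- The curvature of the flat product structure vanishes. [folklore] -/
theorem trivial_curvatureForm (x₀ : M) : (trivial E M F).curvatureForm x₀ = 0 := by
  rw [curvatureForm, trivial_connectionForm, mextDeriv_zero, MForm.oneOnePart_zero]

end HermitianHolomorphicBundle

end Literature.Geometry.Kaehler
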